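import Mathlib
import Summits.ValiantsHypothesis.ValiantsHypothesis.Theses.GrenetZeon
import Summits.ValiantsHypothesis.ValiantsHypothesis.Theorems.GrenetZeonTwoDimCoefficientsDefs
import Summits.ValiantsHypothesis.ValiantsHypothesis.Theorems.GrenetZeonTwoDimCoefficientsStubClassify
import Summits.ValiantsHypothesis.ValiantsHypothesis.Theorems.GrenetZeonTwoDimCoefficientsStubUnitDichotomy
import Summits.ValiantsHypothesis.ValiantsHypothesis.Theorems.GrenetZeonTwoDimCoefficientsStubSplitCase
import Summits.ValiantsHypothesis.ValiantsHypothesis.Theorems.GrenetZeonTwoDimCoefficientsStubDualCase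
import Summits.ValiantsHypothesis.ValiantsHypothesis.Theorems.GrenetZeonHessianRankCodimTwo

/-!
# Skeleton line `dim2_cases` for the crux `TwoDimCoefficients` (stmt-ValiantsHypothesis-8062, route `GrenetZeon`)

**Idea.** A commutative `ℂ`-algebra `R` with `finrank ≤ 2` is `0`, `ℂ`, `ℂ × ℂ` or `ℂ[ε]/ε²`, so an
`(m, ≤ 2)`-representation of `per_n` is either SPLIT, `per_n = α·det A + β·det B`, or DUAL,
`per_n = α·det A + β·tr(adj A · B)` (`A`, `B` affine `m × m` over `ℂ`; Jacobi: `d/dε det(A + εB) =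
tr(adj A · B)`).  In either shape, look at `g := det A` on the permanental hypersurface:

* COMMON ZERO (`Z(per_n) ∩ Z(det A) ≠ ∅`): the dependency crux `HessianRankCodimTwo` (stmt-8061, a
  route item, taken BY NAME as the hypothesis of the composition) supplies a common zero `p` with
  `rank Hess per_n(p) > n²/2`; there the Hessian of the right-hand side has rank `≤ 4m` (split: the
  tree's `rank_hess0_det_le` twice) resp. `≤ 2m + 12m + O(1)` (dual: jet count at a corank-`r` point of
  `A(p)`, `r ≥ 4` impossible, `r ∈ {2,3}` gives `O(1)`, `r = 1` gives `≤ 14m + O(1)` because the only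
  full-rank term `B(p)_{mm}·e₂(L₁₁)` carries the factor `B(p)_{mm} = per_n(p)/β = 0`).
* NO COMMON ZERO: `det A` is a unit of the graded domain `ℂ[x]/(per_n)`, hence `det A = c + per_n·q`
  with `c ≠ 0`; if `q ≠ 0` a Mignon–Ressayre point of `Z(per_n)` pushed to infinity along the cone
  gives a zero of `det A` with Hessian rank `≥ n² − 2`, so `2m ≥ n² − 2` (`stub_unitDichotomy`); if
  `q = 0` (`det A` constant) the split shape hands the unit form to `B`, and the dual shape lands in
  the one sub-case this line does NOT resolve and isolates as its hardest stub, `stub_dualUnipotent`: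
  `per_n = a + b·tr(adj A · B)` with `det A ≡ c ≠ 0` (a nilpotent affine pencil: `A⁻¹ = Σ_{j<m} (−L)^j`),
  where transfer to `dc` only yields `m ≳ n^{2/3}`.

STATE (2026-08-28T02:10Z, val-width-8062-p4: dependency crux 8061 PROVED, composition now hypothesis-free; earlier note of 04:40Z(sic) kept): stubs 1, 2, 3, 4 LANDED and imported (`stub_classify` p577200 val-width-8062-p1;
`stub_unitDichotomy` p580672 val-width-8062-p3 — kernel-plane proof, immune to powerful units, see
`UNIT-CASE-ISOTROPY.md`; `stub_splitCase` p576924 / `stub_dualCase` p576931 val-width-8062-p2).  ONE open stub: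
`stub_dualUnipotent` — OPEN-PROBLEM GRADE (`CALIBRATION-stub_dualUnipotent.md` v4; `OPEN-CORE-…` (p1 g2: sandwich
tpw ≤ m_DU ≤ n·tpw, p588638/p589181; n = 3 data point `HasDim2Repr 3 6` vs `dc(per_3) = 7`, p591026); `PROFILE-BARRIER-…`
(p2 g2: the trace chain of width n^{3/2} carries the full Hessian profile, p589902)).  BEST KNOWN (p3 g2, kernel): general
pencils `2n² ≤ m² + 4n`, i.e. `m ≥ √2·n` (`two_mul_sq_le_of_dualUnipotentRepr`, `…DualUnipotentFlat`, p593595);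
TRIANGULARISABLE pencils `n² ≤ 2kn + m·q` (∀ q ≥ 1, m ≤ kq), i.e. `m ≳ n^{3/2}/(2√2)`
(`sq_le_of_trace_pow_mul_strictUpper`, `…DualUnipotentTriangular`, p593700, via LEMMA_k `…PermanentFlatOrder` p593106:
order-(k+1) flat subspaces of per_n have dim ≤ 2kn; `TRIANGULARISABLE-RUNG.md`).  Located open point: WILD
(non-triangularisable) nilpotent pencils.  The composition below is
`twoDimCoefficients_of_dualUnipotentBound hH stub_dualUnipotent` (tree, `…LinearForm.lean`) unfolded.

Composition `TwoDimCoefficients_of (h : HessianRankCodimTwo) : TwoDimCoefficients` is kernel-checked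
(case split on the shape, maximum of the constants).  VP ≠ VNP is not moved by any of this: the crux
is a two-parameter constant-factor statement (`n² ≤ C·m`), far below the quasi-polynomial regime.
-/

noncomputable section

set_option linter.dupNamespace false

namespace Summit.ValiantsHypothesis.ValiantsHypothesis.Cruxes.TwoDimCoefficients.DimTwoCases

open Literature.Computability.AlgebraicComplexity
open Summit.ValiantsHypothesis.ValiantsHypothesis.Theses.GrenetZeon

/-! ### Vocabulary

The definitions `AffMat`, `IsAffine`, `HasDim2Repr`, `SplitRepr`, `DualRepr`, `DualUnipotentRepr`,
`UnitDichotomy`, `DualUnipotentBound` of this line live VERBATIM (same namespace, same names) in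
the tree file `Theorems/GrenetZeonTwoDimCoefficientsDefs.lean` (p575908, val-width-8062-p2), imported
above. -/

/-! ### Registered stubs

**Stubs 1–4 LANDED** as tree theorems with the registered signatures verbatim and the same
fully-qualified names, imported above: `stub_classify` (p577200, `…StubClassify.lean`),
`stub_unitDichotomy` (p580672, `…StubUnitDichotomy.lean`: if `det A` is zero-free on `Z(per_n)` then
`det A` is constant or `n² ≤ 2m` — kernel plane of `A` at a singular point with non-degenerate
`Hess per`, `per` zero-free hence constant on it, isotropy; the squares `c(1 + per S)²` of
`UNIT-CASE-NOTE.md` are covered), `stub_splitCase` (p576924, `C = 8`), `stub_dualCase` (p576931,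
`C = max 12 C_D`, uniform dual jet count `…DualJet.lean`). -/

/-- **Stub 5 (HARDEST — the isolated open sub-case; the ONLY open stub).** `per_n = a + b·tr(adj A·B)`
with `det A ≡ c ≠ 0`: then `A = A(0)(I + L)` with `L(x)` a linear space of nilpotent matrices,
`adj A·B = c·Σ_{j<m} (−L)^j A(0)⁻¹ B`, so `per_n` is an affine projection of a trace power series of ONE
nilpotent affine pencil — a trace-closed branching-program model of width `m` containing trace-IMM
(kernel: `dualUnipotentRepr_of_trace_prod` p588638 / `dualUnipotentRepr_of_traceIMM` p590215; normal form
`per_n = tr(N^{n−1}M)`, `exists_nilpotent_pencil_of_dualUnipotentRepr` p589181).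
CALIBRATION (`CALIBRATION-stub_dualUnipotent.md` v4, `OPEN-CORE-…`, `PROFILE-BARRIER-…`): OPEN-PROBLEM GRADE —
the claim `n² ≤ C·m` is a size lower bound LINEAR in the number of variables for `per_n`, between the linear
and the quadratic trace-product-width lower bounds for the permanent (both open), in a model that is
pointwise Hessian-blind and even carries the full Hessian profile of `per_n` at width `n^{3/2}`
(`not_dualUnipotentBound_of_hessianProfile`).  PROVED RUNGS: general pencils `m ≥ √2·n`
(`two_mul_sq_le_of_dualUnipotentRepr`: `per_n` is affine along `ker(lin A)`, flat subspaces have dim `≤ 2n`,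
the nilpotent pencil is trace-isotropic); TRIANGULARISABLE pencils `m ≳ n^{3/2}/(2√2)`
(`sq_le_of_trace_pow_mul_strictUpper'`: block grading + order-`k` flat subspaces of `per_n`,
`finrank_le_of_iterD_perPoly_eq_zero`); bounded-rank directions `n² ≤ 2(m·r + 1)`
(`sq_le_of_dualUnipotentRepr_rank`); exchange rate `dualUnipotentBound_of_quartic_dc`; n = 3: `DualUnipotentRepr 3 6`
holds (p591026).  Why it might fail: a width-`o(n²)` unipotent trace expression for `per_n` (none known).
[folklore] -/
theorem stub_dualUnipotent : DualUnipotentBound := by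
  sorry

/-! ### Composition (kernel-checked) -/

/-- The crux unfolds to the `HasDim2Repr` form. [folklore] -/
theorem twoDimCoefficients_iff :
    TwoDimCoefficients ↔ ∃ C n₀ : ℕ, ∀ n ≥ n₀, ∀ m : ℕ, HasDim2Repr n m → n ^ 2 ≤ C * m :=
  Iff.rfl

/-- **`TwoDimCoefficients` from the registered stubs — NO HYPOTHESIS LEFT but the open stub 5.**  The
dependency crux `HessianRankCodimTwo` (stmt-ValiantsHypothesis-8061) is PROVED (2026-08-28,
`Theorems/GrenetZeonHessianRankCodimTwo.lean`, `hessianRankCodimTwo_proof`: bordered Latin planes), so the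
composition takes it BY NAME as a tree theorem instead of a binder.  Classify the shape; take the maximum of
the two constants and thresholds.  (Stubs 1–4 are the imported tree theorems; stub 5 is the `sorry` above;
equivalently `twoDimCoefficients_of_dualUnipotentBound_all stub_dualUnipotent`, and conversely
`TwoDimCoefficients ↔ DualUnipotentBound` is the tree theorem `twoDimCoefficients_iff_dualUnipotentBound_all`,
`…TwoDimCoefficientsAfterCodimTwo.lean`.) [folklore] -/
theorem TwoDimCoefficients_of : TwoDimCoefficients := by
  rw [twoDimCoefficients_iff]
  have hH : HessianRankCodimTwo :=
    Summit.ValiantsHypothesis.ValiantsHypothesis.Theorems.GrenetZeonHessianRankCodimTwo.hessianRankCodimTwo_proof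
  obtain ⟨C₁, n₁, h₁⟩ := stub_splitCase hH stub_unitDichotomy
  obtain ⟨C₂, n₂, h₂⟩ := stub_dualCase hH stub_unitDichotomy stub_dualUnipotent
  refine ⟨max C₁ C₂, max n₁ n₂, fun n hn m hrep => ?_⟩
  rcases stub_classify n m hrep with hs | hd
  · exact (h₁ n (le_of_max_le_left hn) m hs).trans (Nat.mul_le_mul_right _ (le_max_left _ _))
  · exact (h₂ n (le_of_max_le_right hn) m hd).trans (Nat.mul_le_mul_right _ (le_max_right _ _))

end Summit.ValiantsHypothesis.ValiantsHypothesis.Cruxes.TwoDimCoefficients.DimTwoCases
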